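import Mathlib
import Literature.NumberTheory.LFunctions.Zhang2022.Section17U011MeanValue
import Literature.NumberTheory.LFunctions.Zhang2022.Section17ReflectionStep
import Literature.NumberTheory.LFunctions.Zhang2022.Section17Eq171Edges
import Literature.NumberTheory.LFunctions.Zhang2022.Section17Eq177Shift
import Literature.NumberTheory.LFunctions.Zhang2022.Section7aStatements
import Literature.NumberTheory.LFunctions.Zhang2022.Section4Prop22Eventually
import HarnessLib

/-!
# Zhang (2022) §17 p. 97: the step `Z22:§17.u011` DISCHARGED from Proposition 2.2 —
# `Σ_{ψ∈Ψ₁}(p_ψt₀)^{β₃}I₄⁻(ψ) = Σ_{ψ∈Ψ₁}(p_ψt₀)^{β₂}(1/2πi)∫_{𝔍(−α)}𝔨₃*(s,ψ)ω(s)ds + o(𝔓)`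

Topic `Literature/NumberTheory/LFunctions/Zhang2022` (Landau–Siegel audit tree; verdict-neutral).
Y. Zhang, *Discrete mean estimates and the Landau–Siegel zero*, arXiv:2211.02515v1 (2022)
[Zhang2022LandauSiegel] — **an unrefereed manuscript under adjudication; nothing here asserts or
denies its Theorems 1–2, and no claim about Landau–Siegel zeros is made.** ZHANG-L discharge lane,
WP16 (seat zl-w16-p7 as helper of zl-w16-p3 under the leaf `Typed.Section17.Eq17_9Rel`).

§17 p. 97 (tex L4770–L4780): after Lemma 5.1 on `𝔍(−α)` (§17.u010, the tree's
`step17_u010_holds`), "in a way similar to the proof of (15.4)" the sum over `ψ ∈ Ψ₁` of the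
`(pt₀)^{β₃}`-weighted `I₄⁻(ψ) = (1/2πi)∫_{𝔍(−α)}𝔨₃ω` is replaced by that of
`(pt₀)^{β₂}(1/2πi)∫_{𝔍(−α)}𝔨₃*ω` up to `o(𝔓)` — the typed node `Typed.Section17.Step17_u011 c′`
(with the print defect `I₃⁻ ↦ I₄⁻` as typed). This file proves it from Proposition 2.2:

* `step17_u010_sharp` — §17.u010 with the rate Lemma 5.1 actually gives, `𝓛⁻¹²³` (the typed node
  records the printed `O(α⁶) = O(𝓛⁻⁵⁴)`, which is too weak for u011: the mean value below is
  `≍ 𝔓𝓛^{O(70)}`): `‖L(s+β₁,ψ)/L(s,ψ) − M‖ ≤ A𝓛⁻¹²³‖M‖` on `𝔍(−α)`, `M = (pt₀)^{−β₁}L(1−s−β₁,ψ̄)/L(1−s,ψ̄)`,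
  for every `ψ ∈ Ψ` (`Skeleton.LFunction_shift_eq_rel`, functional equation (2.2));
* `kfrak3_weighted_sub_eq` — the pointwise identity
  `(pt₀)^{β₃}𝔨₃ω − (pt₀)^{β₂}𝔨₃*ω = (pt₀)^{β₃}(L(s+β₁,ψ)/L(s,ψ) − M)·BGNN(s)·F(1−s,ψ̄)·ω(s)`
  (`β₂ = β₃ − β₁`);
* `norm_M_le` — `‖M‖ = ‖L(w+β₁,ψ)/L(w,ψ)‖ ≤ C₅₉𝓛⁹`, `w = 1 − s̄ ∈ 𝔍(α)`, for `ψ ∈ Ψ₁` (Lemma 5.9 in its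
  use-range, `lemma59_restricted_of_prop22`, with the clearance from Prop. 2.2 (i),
  `clearance_of_prop22i`; `L(u,ψ̄) = conj L(ū,ψ)`, `Typed.Section13.LFunction_inv_conj`);
* `step17_u011_of_prop22 : 0 ≤ c′ → Prop22 c′ → Step17_u011 c′` and `step17_u011_eventually` — the
  node BY NAME: per `ψ` the difference of the two weighted segment integrals is
  `(1/2π)∫_{−𝓛₁}^{𝓛₁} d_ψ(v)dv` with `‖d_ψ(v)‖ ≤ A𝓛⁻¹²³·C₅₉𝓛⁹·‖BGNN(s_v,ψ)‖‖F(1−s_v,ψ̄)‖‖ω(s_v)‖`;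
  summing over `Ψ₁` UNDER the integral, the loss-free mean value
  `Σ_ψ‖BGNN‖‖F̄‖ ≤ e^{8π}𝔓·K·𝓛⁶²` (`Section17U011MeanValue.sum_norm_BGNN_mul_FpolyBar_le`, Lemma 3.3 (i))
  and `∫_{𝔍(−α)}|ω(s)ds| ≪ 1` ((7.4), `Section7aStatements.eq74_holds`) give `≪ 𝔓𝓛⁹⁺⁶²⁻¹²³ = 𝔓𝓛⁻⁵²`,
  eventually `≤ ε𝔓`. The integrability along `𝔍(−α)` comes from `L(s,ψ) ≠ 0` on `σ = ½ − α`
  (`continuousOn_kfrak3_omega_vertical`) and `L(1−s,ψ̄) ≠ 0` there (`Eq177.differentiableOn_kfrak3Star_omega`).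

Theorems only (no definitions, no new named facts; standard axioms). Hypotheses: `Prop22 c′`
(through Lemma 5.9's use-range form and Prop. 2.2 (i)); Assumption (A) of the node is not used.
WHAT THIS IS NOT: (17.7)–(17.10) or any leaf; the χ-reading questions of the `I₄⁻` chain (RT16-int-1)
do not arise here (both integrands carry the honest `B(s,ψ) = Σ b(n)χψ(n)n^{−s}`).

## References

* Y. Zhang, arXiv:2211.02515v1 (2022), §17 p. 97 (tex L4770–L4780); §5 Lemma 5.1 p. 24, Lemma 5.9
  p. 27; §3 Lemma 3.3 p. 12; §7 (7.4) p. 34; §2 Prop. 2.2, (2.2), (2.13).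
  [cite: Zhang2022LandauSiegel, §17 u011 p. 97]
-/

noncomputable section

open Complex Real Finset ComplexConjugate MeasureTheory intervalIntegral Set

namespace Literature.NumberTheory.LFunctions.Zhang2022.Typed.Section17

open Literature.NumberTheory.LFunctions.Zhang2022
open Literature.NumberTheory.LFunctions.Zhang2022.Section8aStatements
open Skeleton MeanSquareMajorant SmoothWeight

/-! ## §17.u010 at the rate `𝓛⁻¹²³` -/

section U010Sharp

/-- `L₀ ≤ log D` once `D ≥ ⌈exp L₀⌉₊`. [folklore] -/
private theorem le_ell_of_ceil_exp_le_u011 {L₀ : ℝ} {D : ℕ} (hD : ⌈Real.exp L₀⌉₊ ≤ D) :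
    L₀ ≤ ell D := by
  have h : Real.exp L₀ ≤ D := le_trans (Nat.le_ceil _) (by exact_mod_cast hD)
  exact (Real.le_log_iff_exp_le (lt_of_lt_of_le (Real.exp_pos _) h)).mpr h

/-- **§17.u010 with the Lemma-5.1 rate `𝓛⁻¹²³`** (§17 p. 97, tex L4770; the typed `Step17_u010`
records the printed, weaker `O(α⁶)`): for every real `c′` there are `A ≥ 0` and `D₀` with, for `D ≥ D₀`,
EVERY `ψ ∈ Ψ` and `s ∈ 𝔍(−α)` (`Re s = ½ − α`, `|Im s − 2πt₀| ≤ 𝓛₁`), writing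
`M = (pt₀)^{−β₁}L(1−s−β₁,ψ̄)/L(1−s,ψ̄)`: `‖L(s+β₁,ψ)/L(s,ψ) − M‖ ≤ A·𝓛⁻¹²³·‖M‖`
(`Skeleton.LFunction_shift_eq_rel` at `b = b₁`, `|b₁| ≤ 2(1+5|c′|)α`, and `L(s,ψ) = Z(s,ψ)L(1−s,ψ̄)`).
[cite: Zhang2022LandauSiegel, §17 p. 97; §5 Lemma 5.1 p. 24] -/
theorem step17_u010_sharp (c' : ℝ) :
    ∃ A : ℝ, 0 ≤ A ∧ ForAllLarge fun D _ _ => ∀ x : Chr D, ∀ s : ℂ,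
      s.re = 1 / 2 - alpha D → |s.im - 2 * π * t0 D| ≤ ell1 D →
        ‖x.ψ.LFunction (s + beta1 c' D) / x.ψ.LFunction s -
            (((x.p : ℝ) * t0 D : ℝ) : ℂ) ^ (-beta1 c' D) *
              (x.ψ⁻¹.LFunction (1 - s - beta1 c' D) / x.ψ⁻¹.LFunction (1 - s))‖ ≤
          A * (ell D ^ 123)⁻¹ *
            ‖(((x.p : ℝ) * t0 D : ℝ) : ℂ) ^ (-beta1 c' D) *
              (x.ψ⁻¹.LFunction (1 - s - beta1 c' D) / x.ψ⁻¹.LFunction (1 - s))‖ := by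
  set K : ℝ := 2 * (1 + 5 * |c'|) with hK
  have hK0 : 0 ≤ K := by rw [hK]; positivity
  obtain ⟨A, hA0, D₁, h⟩ := LFunction_shift_eq_rel hK0
  refine ⟨A, hA0, ForAllLarge.of_le (max D₁ ⌈Real.exp (K * π + 4)⌉₊)
    fun D _ χ hD hq hχ x s hre him => ?_⟩
  set M : ℂ := (((x.p : ℝ) * t0 D : ℝ) : ℂ) ^ (-beta1 c' D) *
      (x.ψ⁻¹.LFunction (1 - s - beta1 c' D) / x.ψ⁻¹.LFunction (1 - s)) with hM
  -- sizes of the parameters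
  have hD₁ : D₁ ≤ D := le_trans (le_max_left _ _) hD
  have hLK : K * π + 4 ≤ ell D := le_ell_of_ceil_exp_le_u011 (le_trans (le_max_right _ _) hD)
  have hKπ : 0 ≤ K * π := by positivity
  have hL2 : 2 ≤ ell D := by linarith
  have hL1 : 1 ≤ ell D := by linarith
  have hL0 : 0 < ell D := by linarith
  have hα : 0 < alpha D := alpha_pos' hL0
  have hαℓ : alpha D * ell D ≤ 1 := alpha_mul_ell_le_one hL2
  -- the segment `𝔍(−α)` lies in Lemma 5.1's range; `Im s > 0`
  have hR51 : InRange51 D s := by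
    refine ⟨?_, ?_⟩
    · rw [hre, show 1 / 2 - alpha D - 1 / 2 = -alpha D by ring, abs_neg, abs_of_pos hα]
    · have : ell1 D < ell1 D + 2 := by linarith
      exact lt_of_le_of_lt him this
  have hspos : 0 < s.im := by
    have ht0 : t0 D = ell D ^ 519 := rfl
    have hell1 : ell1 D = ell D ^ 405 := rfl
    have h405 : ell D ^ 405 ≤ ell D ^ 519 := pow_le_pow_right₀ hL1 (by norm_num)
    have h519' : (1 : ℝ) ≤ ell D ^ 519 := one_le_pow₀ hL1
    have hπ519 : 3 * ell D ^ 519 ≤ π * ell D ^ 519 :=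
      mul_le_mul_of_nonneg_right Real.pi_gt_three.le (by linarith)
    have h1 := (abs_le.mp him).1
    rw [hell1, ht0] at h1
    linarith
  -- `β₁ = ib₁`, `|b₁| ≤ Kα`
  set b₁ : ℝ := alpha D * (1 - 5 * c' * alpha D * ell D) with hb₁
  have hβ₁ : beta1 c' D = (b₁ : ℂ) * I := by simp only [beta1, hb₁]; push_cast; ring
  have hcαℓ : |c' * alpha D * ell D| ≤ |c'| := by
    rw [mul_assoc, abs_mul]
    calc |c'| * |alpha D * ell D| ≤ |c'| * 1 := by
          refine mul_le_mul_of_nonneg_left ?_ (abs_nonneg _)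
          rw [abs_of_nonneg (by positivity)]; exact hαℓ
      _ = |c'| := mul_one _
  have hb₁K : |b₁| ≤ K * alpha D := by
    rw [hb₁, abs_mul, abs_of_pos hα]
    have h1 : |1 - 5 * c' * alpha D * ell D| ≤ 1 + 5 * |c'| := by
      calc |1 - 5 * c' * alpha D * ell D| ≤ |(1 : ℝ)| + |5 * c' * alpha D * ell D| := abs_sub _ _
        _ = 1 + 5 * |c' * alpha D * ell D| := by
            rw [abs_one, show 5 * c' * alpha D * ell D = 5 * (c' * alpha D * ell D) by ring,
              abs_mul, abs_of_pos (by norm_num : (0:ℝ) < 5)]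
        _ ≤ 1 + 5 * |c'| := by linarith
    calc alpha D * |1 - 5 * c' * alpha D * ell D| ≤ alpha D * (1 + 5 * |c'|) :=
          mul_le_mul_of_nonneg_left h1 hα.le
      _ ≤ K * alpha D := by
          rw [hK, show 2 * (1 + 5 * |c'|) * alpha D
              = alpha D * (1 + 5 * |c'|) + alpha D * (1 + 5 * |c'|) by ring]
          have h0 : 0 ≤ alpha D * (1 + 5 * |c'|) := by positivity
          linarith
  -- the relative shift and the functional equation at `s`
  obtain ⟨ε, hL₁, hε⟩ := h D χ hD₁ hq hχ x s hR51 b₁ hb₁K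
  set Z : ℂ := GammaFactor.Zfac x.ψ s with hZ
  set u : ℂ := (((x.p : ℝ) * t0 D : ℝ) : ℂ) ^ (-((b₁ : ℂ) * I)) with hu
  have hZne : Z ≠ 0 := GammaFactor.Zfac_ne_zero x.prim hspos
  have hFE0 : x.ψ.LFunction s = Z * x.ψ⁻¹.LFunction (1 - s) :=
    GammaFactor.LFunction_eq_Zfac_mul x.prim x.p_ne_one hspos.ne'
  set L' : ℂ := x.ψ⁻¹.LFunction (1 - s) with hL'
  set L₁ : ℂ := x.ψ⁻¹.LFunction (1 - s - beta1 c' D) with hL₁def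
  have hL₁' : x.ψ.LFunction (s + beta1 c' D) = Z * u * (1 + ε) * L₁ := by
    rw [hβ₁, hL₁, hL₁def, hβ₁]
  have hMu : M = u * (L₁ / L') := by rw [hM, hβ₁]
  -- the exact identity `L(s+β₁,ψ)/L(s,ψ) = M(1 + ε)`
  have hLHS : x.ψ.LFunction (s + beta1 c' D) / x.ψ.LFunction s = M * (1 + ε) := by
    rw [hL₁', hFE0, hMu, show Z * u * (1 + ε) * L₁ = Z * (u * (1 + ε) * L₁) by ring,
      mul_div_mul_left _ _ hZne]
    ring
  rw [hLHS, show M * (1 + ε) - M = M * ε by ring, norm_mul]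
  calc ‖M‖ * ‖ε‖ ≤ ‖M‖ * (A * (ell D ^ 123)⁻¹) := mul_le_mul_of_nonneg_left hε (norm_nonneg _)
    _ = A * (ell D ^ 123)⁻¹ * ‖M‖ := by ring

end U010Sharp

/-! ## The pointwise identity and the size of the reflected ratio -/

section Pointwise

variable (c' : ℝ) {D : ℕ} [NeZero D] (χ : DirichletCharacter ℂ D) (x : Chr D)

omit [NeZero D] χ in
/-- `pt₀ > 0` for `p ∼ P` and `𝓛 > 0`. [cite: Zhang2022LandauSiegel, §2 (2.8)] -/
theorem pt0_pos (hL : 0 < ell D) : 0 < (x.p : ℝ) * t0 D := by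
  have hp : (0 : ℝ) < x.p := by exact_mod_cast x.prime.pos
  have ht : 0 < t0 D := by rw [show t0 D = ell D ^ 519 from rfl]; positivity
  exact mul_pos hp ht

omit [NeZero D] χ in
/-- `‖(pt₀)^{β}‖ = 1` for the purely imaginary shifts `β ∈ {−β₁, β₂, β₃}` ((2.13); `𝓛 > 0`).
[cite: Zhang2022LandauSiegel, §2 (2.13)] -/
theorem norm_pt0_cpow_shifts (hL : 0 < ell D) :
    ‖(((x.p : ℝ) * t0 D : ℝ) : ℂ) ^ (-beta1 c' D)‖ = 1 ∧
      ‖(((x.p : ℝ) * t0 D : ℝ) : ℂ) ^ beta2 c' D‖ = 1 ∧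
        ‖(((x.p : ℝ) * t0 D : ℝ) : ℂ) ^ beta3 c' D‖ = 1 := by
  have hpt := pt0_pos x hL
  refine ⟨?_, ?_, ?_⟩ <;> rw [Complex.norm_cpow_eq_rpow_re_of_pos hpt] <;>
    simp [beta1, beta2, beta3]

omit [NeZero D] χ x in
/-- `β₂ = β₃ − β₁` ((2.13): `2(1 + c′α𝓛) = 3(1 − c′α𝓛) − (1 − 5c′α𝓛)`). [cite: Zhang2022LandauSiegel, §2 (2.13)] -/
theorem beta2_eq_beta3_sub_beta1 : beta2 c' D = beta3 c' D + -beta1 c' D := by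
  simp only [beta1, beta2, beta3]
  push_cast
  ring

omit [NeZero D] in
/-- **The pointwise identity behind §17.u011**: for every `s` with `pt₀ ≠ 0`,
`(pt₀)^{β₃}𝔨₃(s,ψ)ω(s) − (pt₀)^{β₂}𝔨₃*(s,ψ)ω(s) =
(pt₀)^{β₃}·(L(s+β₁,ψ)/L(s,ψ) − M)·(B(s,ψ)G(s,ψ)N(s+β₂,ψ)N(s+β₃,ψ))·F(1−s,ψ̄)·ω(s)`,
`M = (pt₀)^{−β₁}L(1−s−β₁,ψ̄)/L(1−s,ψ̄)` (`(pt₀)^{β₂} = (pt₀)^{β₃}(pt₀)^{−β₁}`; `𝓛 > 0`).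
[cite: Zhang2022LandauSiegel, §17 p. 97 (tex L4770–L4780)] -/
theorem kfrak3_weighted_sub_eq (hL : 0 < ell D) (s : ℂ) :
    (((x.p : ℝ) * t0 D : ℝ) : ℂ) ^ beta3 c' D * (kfrak3 c' χ x s * omegaW D s) -
        (((x.p : ℝ) * t0 D : ℝ) : ℂ) ^ beta2 c' D * (kfrak3Star c' χ x s * omegaW D s) =
      (((x.p : ℝ) * t0 D : ℝ) : ℂ) ^ beta3 c' D *
        (x.ψ.LFunction (s + beta1 c' D) / x.ψ.LFunction s -
          (((x.p : ℝ) * t0 D : ℝ) : ℂ) ^ (-beta1 c' D) *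
            (x.ψ⁻¹.LFunction (1 - s - beta1 c' D) / x.ψ⁻¹.LFunction (1 - s))) *
        ((Bpoly χ x s * Gpoly χ x s * Nchar D (psiFn x) (s + beta2 c' D) *
            Nchar D (psiFn x) (s + beta3 c' D)) * FpolyBar χ x (1 - s) * omegaW D s) := by
  have hpt : ((((x.p : ℝ) * t0 D : ℝ) : ℂ)) ≠ 0 := by
    exact_mod_cast (pt0_pos x hL).ne'
  have h2 : (((x.p : ℝ) * t0 D : ℝ) : ℂ) ^ beta2 c' D =
      (((x.p : ℝ) * t0 D : ℝ) : ℂ) ^ beta3 c' D * (((x.p : ℝ) * t0 D : ℝ) : ℂ) ^ (-beta1 c' D) := by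
    rw [← Complex.cpow_add _ _ hpt, ← beta2_eq_beta3_sub_beta1 c']
  rw [h2, kfrak3, kfrak3Star]
  ring

omit [NeZero D] χ x in
/-- `conj β₁ = −β₁` (`β₁ ∈ iℝ`). [cite: Zhang2022LandauSiegel, §2 (2.13)] -/
private theorem conj_beta1 : conj (beta1 c' D) = -beta1 c' D := by
  simp only [beta1, map_mul, Complex.conj_I, Complex.conj_ofReal]
  ring

omit [NeZero D] χ in
/-- **The reflected ratio is a ratio at the reflected point**: `‖L(1−s−β₁,ψ̄)/L(1−s,ψ̄)‖ =
‖L(w+β₁,ψ)/L(w,ψ)‖`, `w = 1 − s̄` (`L(u,ψ̄) = conj L(ū,ψ)`, `β̄₁ = −β₁`).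
[cite: Zhang2022LandauSiegel, §13 p. 74; §17 p. 97] -/
theorem norm_reflected_ratio_eq (s : ℂ) :
    ‖x.ψ⁻¹.LFunction (1 - s - beta1 c' D) / x.ψ⁻¹.LFunction (1 - s)‖ =
      ‖x.ψ.LFunction ((1 - conj s) + beta1 c' D) / x.ψ.LFunction (1 - conj s)‖ := by
  rw [Typed.Section13.LFunction_inv_conj x, Typed.Section13.LFunction_inv_conj x, ← map_div₀,
    Complex.norm_conj, map_sub, map_sub, map_one, conj_beta1]
  ring_nf

end Pointwise

/-! ## Sizes of the parameters used in the assembly -/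

section Sizes

variable {D : ℕ}

/-- `D ≥ 3` once `𝓛 ≥ 80` (`D ≠ 0`). [cite: Zhang2022LandauSiegel, §2 p. 4] -/
private theorem three_le_of_ell [NeZero D] (h80 : 80 ≤ ell D) : 3 ≤ D := by
  have hDpos : 0 < D := Nat.pos_of_ne_zero (NeZero.ne D)
  by_contra h
  have hD2 : (D : ℝ) ≤ 2 := by exact_mod_cast (by omega : D ≤ 2)
  have : ell D ≤ Real.log 2 := Real.log_le_log (by exact_mod_cast hDpos) hD2
  linarith [Real.log_two_lt_d9]

/-- `D⁴ ≤ ⌊P⌋` (`4𝓛 ≤ 𝓛⁹`; `D ≥ 1`, `𝓛 ≥ 4`). [cite: Zhang2022LandauSiegel, §2 (2.6)] -/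
private theorem pow_four_le_floor_bigP (hD : 0 < D) (hℓ4 : 4 ≤ ell D) : D ^ 4 ≤ ⌊bigP D⌋₊ := by
  have hℓ1 : 1 ≤ ell D := by linarith
  refine Nat.le_floor ?_
  have hD0 : (0 : ℝ) < D := by exact_mod_cast hD
  have hD4 : ((D ^ 4 : ℕ) : ℝ) = Real.exp (4 * ell D) := by
    rw [ell, show (4 : ℝ) * Real.log D = ((4 : ℕ) : ℝ) * Real.log D by norm_num,
      Real.exp_nat_mul, Real.exp_log hD0]
    push_cast; ring
  rw [hD4, bigP, Real.exp_le_exp]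
  calc 4 * ell D ≤ ell D * ell D := by nlinarith
    _ = ell D ^ 2 := (sq _).symm
    _ ≤ ell D ^ 9 := pow_le_pow_right₀ hℓ1 (by norm_num)

/-- `log⌊P⌋ ≤ 𝓛⁹` (`⌊P⌋ ≥ 1`). [cite: Zhang2022LandauSiegel, §2 (2.6)] -/
private theorem log_floor_bigP_le (hP : 2 ≤ ⌊bigP D⌋₊) : Real.log ⌊bigP D⌋₊ ≤ ell D ^ 9 := by
  have hP1 : (0 : ℝ) ≤ bigP D := (Real.exp_pos _).le
  have h0 : (0 : ℝ) < ⌊bigP D⌋₊ := by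
    have : (2 : ℝ) ≤ ⌊bigP D⌋₊ := by exact_mod_cast hP
    linarith
  calc Real.log ⌊bigP D⌋₊ ≤ Real.log (bigP D) := Real.log_le_log h0 (Nat.floor_le hP1)
    _ = ell D ^ 9 := by rw [bigP, Real.log_exp]

/-- `log⌈2T²⌉ ≤ 3𝓛²` (`⌈2T²⌉ ≤ T³` as `T ≥ 3`; `log T = 𝓛^{1.1} ≤ 𝓛²`; `𝓛 ≥ 2`).
[cite: Zhang2022LandauSiegel, §2 (2.6)] -/
private theorem log_ceil_le (hℓ2 : 2 ≤ ell D) (hy : 2 ≤ ⌈2 * bigT D ^ 2⌉₊) :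
    Real.log ⌈2 * bigT D ^ 2⌉₊ ≤ 3 * ell D ^ 2 := by
  have hℓ1 : 1 ≤ ell D := by linarith
  have hℓ0 : 0 < ell D := by linarith
  have hT0 : 0 < bigT D := Real.exp_pos _
  have h11ge : ell D ≤ ell D ^ (1.1 : ℝ) := Real.self_le_rpow_of_one_le hℓ1 (by norm_num)
  have h11 : ell D ^ (1.1 : ℝ) ≤ ell D ^ 2 := by
    have := Real.rpow_le_rpow_of_exponent_le hℓ1 (by norm_num : (1.1 : ℝ) ≤ 2)
    rwa [Real.rpow_two] at this
  have hT3 : (3 : ℝ) ≤ bigT D := by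
    have hl3 : Real.log 3 < 2 := by
      have := Real.log_lt_sub_one_of_pos (by norm_num : (0:ℝ) < 3) (by norm_num)
      linarith
    have h3 : Real.log 3 ≤ ell D ^ (1.1 : ℝ) := by linarith
    calc (3 : ℝ) = Real.exp (Real.log 3) := (Real.exp_log (by norm_num)).symm
      _ ≤ bigT D := by rw [bigT]; exact Real.exp_le_exp.mpr h3
  have hy0 : (0 : ℝ) < ⌈2 * bigT D ^ 2⌉₊ := by
    have : (2 : ℝ) ≤ ⌈2 * bigT D ^ 2⌉₊ := by exact_mod_cast hy
    linarith
  have hyle : (⌈2 * bigT D ^ 2⌉₊ : ℝ) ≤ bigT D ^ 3 := by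
    have h1 : (⌈2 * bigT D ^ 2⌉₊ : ℝ) < 2 * bigT D ^ 2 + 1 := Nat.ceil_lt_add_one (by positivity)
    have h2 : 2 * bigT D ^ 2 + 1 ≤ bigT D ^ 3 := by nlinarith
    linarith
  calc Real.log ⌈2 * bigT D ^ 2⌉₊ ≤ Real.log (bigT D ^ 3) := Real.log_le_log hy0 hyle
    _ = 3 * ell D ^ (1.1 : ℝ) := by rw [Real.log_pow, bigT, Real.log_exp]; push_cast; ring
    _ ≤ 3 * ell D ^ 2 := by linarith

/-- `log D⁴ = 4𝓛`. [cite: Zhang2022LandauSiegel, §2 p. 4] -/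
private theorem log_pow_four (D : ℕ) : Real.log ((D ^ 4 : ℕ) : ℝ) = 4 * ell D := by
  rw [ell, show ((D ^ 4 : ℕ) : ℝ) = (D : ℝ) ^ 4 by push_cast; ring, Real.log_pow]
  push_cast; ring

/-- The logarithmic factor of the mean value, bounded by a power of `𝓛`:
`√(K²·M₁·(log⌊P⌋)⁴(log⌈2T²⌉)²⁰(log D⁴)¹² · M₂(log⌊P⌋)⁴) ≤ K·3¹⁰4⁶·√(M₁M₂)·𝓛⁶²` (`K, M₁, M₂ ≥ 0`).
[cite: Zhang2022LandauSiegel, §17 p. 97] -/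
private theorem sqrt_logs_le {K M₁ M₂ : ℝ} (hK : 0 ≤ K) (hM₁ : 0 ≤ M₁) (hM₂ : 0 ≤ M₂)
    (hℓ4 : 4 ≤ ell D) (hP : 2 ≤ ⌊bigP D⌋₊) (hy : 2 ≤ ⌈2 * bigT D ^ 2⌉₊) :
    Real.sqrt ((K ^ 2 * (M₁ * (Real.log ⌊bigP D⌋₊ ^ 4 * Real.log ⌈2 * bigT D ^ 2⌉₊ ^ 20 *
        Real.log ((D ^ 4 : ℕ) : ℝ) ^ 12))) * (M₂ * Real.log ⌊bigP D⌋₊ ^ 4)) ≤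
      K * (3 ^ 10 * 4 ^ 6) * Real.sqrt (M₁ * M₂) * ell D ^ 62 := by
  have hℓ1 : 1 ≤ ell D := by linarith
  have hℓ0 : 0 ≤ ell D := by linarith
  have hlogP := log_floor_bigP_le hP
  have hlogP0 : 0 ≤ Real.log ⌊bigP D⌋₊ := Real.log_natCast_nonneg _
  have hlogy := log_ceil_le (D := D) (by linarith) hy
  have hlogy0 : 0 ≤ Real.log ⌈2 * bigT D ^ 2⌉₊ := Real.log_natCast_nonneg _
  rw [log_pow_four D]
  have e1 : Real.log ⌊bigP D⌋₊ ^ 4 ≤ (ell D ^ 9) ^ 4 := pow_le_pow_left₀ hlogP0 hlogP 4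
  have e2 : Real.log ⌈2 * bigT D ^ 2⌉₊ ^ 20 ≤ (3 * ell D ^ 2) ^ 20 := pow_le_pow_left₀ hlogy0 hlogy 20
  have hlhs : K ^ 2 * (M₁ * (Real.log ⌊bigP D⌋₊ ^ 4 * Real.log ⌈2 * bigT D ^ 2⌉₊ ^ 20 *
        (4 * ell D) ^ 12)) * (M₂ * Real.log ⌊bigP D⌋₊ ^ 4) ≤
      (K * (3 ^ 10 * 4 ^ 6) * ell D ^ 62) ^ 2 * (M₁ * M₂) := by
    calc K ^ 2 * (M₁ * (Real.log ⌊bigP D⌋₊ ^ 4 * Real.log ⌈2 * bigT D ^ 2⌉₊ ^ 20 *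
          (4 * ell D) ^ 12)) * (M₂ * Real.log ⌊bigP D⌋₊ ^ 4)
        ≤ K ^ 2 * (M₁ * ((ell D ^ 9) ^ 4 * (3 * ell D ^ 2) ^ 20 * (4 * ell D) ^ 12)) *
            (M₂ * (ell D ^ 9) ^ 4) := by gcongr
      _ = (K * (3 ^ 10 * 4 ^ 6) * ell D ^ 62) ^ 2 * (M₁ * M₂) := by ring
  calc _ ≤ Real.sqrt ((K * (3 ^ 10 * 4 ^ 6) * ell D ^ 62) ^ 2 * (M₁ * M₂)) := Real.sqrt_le_sqrt hlhs
    _ = K * (3 ^ 10 * 4 ^ 6) * ell D ^ 62 * Real.sqrt (M₁ * M₂) := by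
        rw [Real.sqrt_mul (sq_nonneg _), Real.sqrt_sq (by positivity)]
    _ = _ := by ring

/-- `𝓛⁻¹²³·𝓛⁹·𝓛⁶² = 𝓛⁻⁵²` (`𝓛 > 0`). [cite: Zhang2022LandauSiegel, §17 p. 97] -/
private theorem ell_pow_combine (hℓ0 : 0 < ell D) :
    (ell D ^ 123)⁻¹ * ell D ^ 9 * ell D ^ 62 = (ell D ^ 52)⁻¹ := by
  have hne : ell D ^ 123 ≠ 0 := pow_ne_zero _ hℓ0.ne'
  have h : (ell D ^ 123)⁻¹ * ell D ^ 9 * ell D ^ 62 * ell D ^ 52 = 1 := by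
    rw [show (ell D ^ 123)⁻¹ * ell D ^ 9 * ell D ^ 62 * ell D ^ 52 =
      (ell D ^ 123)⁻¹ * ell D ^ 123 by ring]
    exact inv_mul_cancel₀ hne
  exact eq_inv_of_mul_eq_one_left h

/-- The last step: `K₀𝓛⁻⁵² ≤ ε` once `𝓛 ≥ K₀/ε + 1` (`K₀ ≥ 0`, `ε > 0`, `𝓛 ≥ 1`).
[cite: Zhang2022LandauSiegel, §17 p. 97] -/
private theorem final_le {K₀ ε : ℝ} (hε : 0 < ε) (hℓ1 : 1 ≤ ell D)
    (hKε : K₀ / ε + 1 ≤ ell D) : K₀ * (ell D ^ 52)⁻¹ ≤ ε := by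
  have hℓ0 : 0 < ell D := by linarith
  have h52 : ell D ≤ ell D ^ 52 := le_self_pow₀ hℓ1 (by norm_num)
  have hKℓ : K₀ ≤ ell D * ε :=
    (div_le_iff₀ hε).mp ((le_add_of_nonneg_right zero_le_one).trans hKε)
  rw [mul_inv_le_iff₀ (pow_pos hℓ0 52)]
  calc K₀ ≤ ell D * ε := hKℓ
    _ = ε * ell D := mul_comm _ _
    _ ≤ ε * ell D ^ 52 := mul_le_mul_of_nonneg_left h52 hε.le

end Sizes

/-! ## The assembly: §17.u011 from Proposition 2.2 -/

section Assembly

variable {c' : ℝ}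

/-- The path of `𝔍(−α)`: `−α + s₀ + iv = (½ − α) + i(2πt₀ + v)`. [cite: Zhang2022LandauSiegel, §7 p. 32] -/
private theorem path_eq (D : ℕ) (v : ℝ) :
    (-(alpha D : ℂ)) + s0 (t0 D) + v * I =
      (((1 / 2 - alpha D : ℝ)) : ℂ) + ((2 * π * t0 D + v : ℝ) : ℂ) * I := by
  rw [s0_def]; push_cast; ring

/-- The path of `𝔍(α)`: `α + s₀ + iv = (½ + α) + i(2πt₀ + v)`. [cite: Zhang2022LandauSiegel, §7 p. 32] -/
private theorem path_eq' (D : ℕ) (v : ℝ) :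
    ((alpha D : ℝ) : ℂ) + s0 (t0 D) + v * I =
      (((1 / 2 + alpha D : ℝ)) : ℂ) + ((2 * π * t0 D + v : ℝ) : ℂ) * I := by
  rw [s0_def]; push_cast; ring

/-- The reflected path: `1 − conj(−α + s₀ + iv) = α + s₀ + iv ∈ 𝔍(α)`. [cite: Zhang2022LandauSiegel, §8 p. 16] -/
private theorem one_sub_conj_path (D : ℕ) (v : ℝ) :
    1 - conj ((-(alpha D : ℂ)) + s0 (t0 D) + v * I) = ((alpha D : ℝ) : ℂ) + s0 (t0 D) + v * I := by
  have h := Lemma81.one_sub_conj_eq (t0 D) (-alpha D) v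
  rw [neg_neg] at h
  rw [← h]; push_cast; ring_nf

/-- Difference of two WEIGHTED segment integrals over the same segment, as one integral (both
integrands interval-integrable along the path). [folklore] -/
private theorem weighted_segInt_sub {t₀ L₁ : ℝ} (z a b : ℂ) {F G : ℂ → ℂ}
    (hF : IntervalIntegrable (fun v : ℝ => F (z + s0 t₀ + v * I)) volume (-L₁) L₁)
    (hG : IntervalIntegrable (fun v : ℝ => G (z + s0 t₀ + v * I)) volume (-L₁) L₁) :
    a * Lemma81.segInt t₀ L₁ z F - b * Lemma81.segInt t₀ L₁ z G =
      (1 / (2 * π) : ℂ) *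
        ∫ v in (-L₁)..L₁, (a * F (z + s0 t₀ + v * I) - b * G (z + s0 t₀ + v * I)) := by
  have h1 : (∫ v in (-L₁)..L₁, a * F (z + s0 t₀ + v * I)) = a * ∫ v in (-L₁)..L₁, F (z + s0 t₀ + v * I) :=
    intervalIntegral.integral_const_mul _ _
  have h2 : (∫ v in (-L₁)..L₁, b * G (z + s0 t₀ + v * I)) = b * ∫ v in (-L₁)..L₁, G (z + s0 t₀ + v * I) :=
    intervalIntegral.integral_const_mul _ _
  rw [Lemma81.segInt, Lemma81.segInt, intervalIntegral.integral_sub (hF.const_mul a) (hG.const_mul b),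
    h1, h2]
  ring

/-- **§17.u011 DISCHARGED from Proposition 2.2** (§17 p. 97, tex L4775): for `0 ≤ c′` and
`Prop22 c′`, `Typed.Section17.Step17_u011 c′` holds — for every `ε > 0`, eventually in `D`,
`‖Σ_{ψ∈Ψ₁}(p_ψt₀)^{β₃}I₄⁻(ψ) − Σ_{ψ∈Ψ₁}(p_ψt₀)^{β₂}(1/2πi)∫_{𝔍(−α)}𝔨₃*(s,ψ)ω(s)ds‖ ≤ ε𝔓`.
Route (the source's "in a way similar to the proof of (15.4)", made explicit): §17.u010 at rate
`𝓛⁻¹²³`, Lemma 5.9 for the reflected ratio (`≪ 𝓛⁹`), the loss-free mean value of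
`B·G·N·N·F̄` over `ψ` (Lemma 3.3 (i), `≪ 𝔓𝓛⁶²`), and `∫_{𝔍(−α)}|ω| ≪ 1` ((7.4)): total `≪ 𝔓𝓛⁻⁵²`.
[cite: Zhang2022LandauSiegel, §17 u011 p. 97] -/
theorem step17_u011_of_prop22 (hc' : 0 ≤ c') (h22 : Prop22 c') : Step17_u011 c' := by
  intro ε hε
  obtain ⟨C₅₉, D₅₉, h59⟩ := lemma59_restricted_of_prop22 hc' h22 1 one_pos
  obtain ⟨D₂₂, h22i⟩ := h22.1
  obtain ⟨A, hA0, D_A, hA⟩ := step17_u010_sharp c'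
  obtain ⟨C₇₄, D₇₄, h74⟩ := Section7aStatements.eq74_holds
  -- the constant of the final bound `K₀·𝓛⁻⁵²·𝔓`
  set Kι : ℝ := (1 + ‖iota2‖) * (‖iota3‖ + ‖iota4‖) with hKι
  set K₀ : ℝ := 1 / (2 * π) * (A * |C₅₉|) * |C₇₄| *
    (Real.exp (8 * π) * (Kι * (3 ^ 10 * 4 ^ 6) * Real.sqrt (majorantConst 36 14 * majorantConst 4 4)))
    with hK₀
  have hK₀0 : 0 ≤ K₀ := by rw [hK₀, hKι]; positivity
  set L₀ : ℝ := max 80 (max (4 * π * |c'| + 1) (K₀ / ε + 1)) with hL₀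
  refine ⟨max D₅₉ (max D₂₂ (max D_A (max D₇₄ ⌈Real.exp L₀⌉₊))), ?_⟩
  intro D _ χ hD hq hp _
  -- thresholds
  have hD59 : D₅₉ ≤ D := (le_max_left _ _).trans hD
  have hD22 : D₂₂ ≤ D := (le_max_left _ _).trans ((le_max_right _ _).trans hD)
  have hDA : D_A ≤ D := (le_max_left _ _).trans ((le_max_right _ _).trans ((le_max_right _ _).trans hD))
  have hD74 : D₇₄ ≤ D :=
    (le_max_left _ _).trans ((le_max_right _ _).trans ((le_max_right _ _).trans
      ((le_max_right _ _).trans hD)))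
  have hDℓ : ⌈Real.exp L₀⌉₊ ≤ D :=
    (le_max_right _ _).trans ((le_max_right _ _).trans ((le_max_right _ _).trans
      ((le_max_right _ _).trans hD)))
  have hL : L₀ ≤ ell D := le_ell_of_ceil_exp_le_u011 hDℓ
  have h80 : 80 ≤ ell D := (le_max_left _ _).trans hL
  have hcL : 4 * π * |c'| + 1 ≤ ell D := (le_max_left _ _).trans ((le_max_right _ _).trans hL)
  have hKε : K₀ / ε + 1 ≤ ell D := (le_max_right _ _).trans ((le_max_right _ _).trans hL)
  obtain ⟨hα0, hαeq, hα100, -⟩ := alpha_sizes171 h80 hcL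
  have hℓ0 : 0 < ell D := by linarith
  have hℓ1 : 1 ≤ ell D := by linarith
  have hℓ4 : 4 ≤ ell D := by linarith
  have hα4 : alpha D ≤ 1 / 4 := by linarith
  have hα1 : alpha D ≤ 1 := by linarith
  have hDpos : 0 < D := Nat.pos_of_ne_zero (NeZero.ne D)
  have hD3 : 3 ≤ D := three_le_of_ell h80
  have hℓ1pos : 0 < ell1 D := by rw [show ell1 D = ell D ^ 405 from rfl]; positivity
  have hDP : D ^ 4 ≤ ⌊bigP D⌋₊ := pow_four_le_floor_bigP hDpos hℓ4
  -- Prop. 2.2 (i) for the characters of `Ψ₁`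
  have h22x : ∀ x ∈ PsiOne χ, ∀ s ∈ prodZeroSetOmega χ x, s.re = 1 / 2 := h22i D χ hD22 hq hp
  -- (1) the per-`ψ`, per-`v` bound on the difference of the integrands
  set E : ℝ := A * (ell D ^ 123)⁻¹ * (|C₅₉| * ell D ^ 9) with hE
  have hE0 : 0 ≤ E := by rw [hE]; positivity
  set z : ℂ := -(alpha D : ℂ) with hz
  have hpath : ∀ v : ℝ, z + s0 (t0 D) + v * I =
      (((1 / 2 - alpha D : ℝ)) : ℂ) + ((2 * π * t0 D + v : ℝ) : ℂ) * I := fun v => path_eq D v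
  have hre_v : ∀ v : ℝ, (z + s0 (t0 D) + v * I).re = 1 / 2 - alpha D := fun v => by
    rw [hpath]; simp
  have him_v : ∀ v : ℝ, (z + s0 (t0 D) + v * I).im = 2 * π * t0 D + v := fun v => by
    rw [hpath]; simp
  have hdiff : ∀ x ∈ PsiOne χ, ∀ v ∈ Icc (-ell1 D) (ell1 D),
      ‖(((x.p : ℝ) * t0 D : ℝ) : ℂ) ^ beta3 c' D *
            (kfrak3 c' χ x (z + s0 (t0 D) + v * I) * omegaW D (z + s0 (t0 D) + v * I)) -
          (((x.p : ℝ) * t0 D : ℝ) : ℂ) ^ beta2 c' D *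
            (kfrak3Star c' χ x (z + s0 (t0 D) + v * I) * omegaW D (z + s0 (t0 D) + v * I))‖ ≤
        E * (‖Bpoly χ x (z + s0 (t0 D) + v * I) * Gpoly χ x (z + s0 (t0 D) + v * I) *
              Nchar D (psiFn x) (z + s0 (t0 D) + v * I + beta2 c' D) *
              Nchar D (psiFn x) (z + s0 (t0 D) + v * I + beta3 c' D)‖ *
            ‖FpolyBar χ x (1 - (z + s0 (t0 D) + v * I))‖) *
          ‖omegaW D (z + s0 (t0 D) + v * I)‖ := by
    intro x hx v hv
    set s : ℂ := z + s0 (t0 D) + v * I with hs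
    obtain ⟨hn1, -, hn3⟩ := norm_pt0_cpow_shifts c' x hℓ0
    have hsre : s.re = 1 / 2 - alpha D := hre_v v
    have hsim : |s.im - 2 * π * t0 D| ≤ ell1 D := by
      rw [him_v, show 2 * π * t0 D + v - 2 * π * t0 D = v by ring, abs_le]; exact hv
    -- §17.u010 (sharp) at `s`
    have h10 := hA D χ hDA hq hp x s hsre hsim
    -- Lemma 5.9 at the reflected point `w = 1 − s̄ ∈ 𝔍(α)`
    set w : ℂ := 1 - conj s with hw
    have hw' : w = ((alpha D : ℝ) : ℂ) + s0 (t0 D) + v * I := one_sub_conj_path D v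
    have hwre : w.re = 1 / 2 + alpha D := by rw [hw', path_eq' D v]; simp
    have hwim : w.im = 2 * π * t0 D + v := by rw [hw', path_eq' D v]; simp
    have hw1 : |w.re - 1 / 2| ≤ alpha D := by
      rw [hwre, show 1 / 2 + alpha D - 1 / 2 = alpha D by ring, abs_of_pos hα0]
    have hw1' : |w.re - 1 / 2| = alpha D := by
      rw [hwre, show 1 / 2 + alpha D - 1 / 2 = alpha D by ring, abs_of_pos hα0]
    have hw2 : |w.im - 2 * π * t0 D| ≤ ell1 D + 1 / 4 := by
      rw [hwim, show 2 * π * t0 D + v - 2 * π * t0 D = v by ring, abs_le]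
      constructor <;> linarith [hv.1, hv.2]
    have hw3 : |w.im - 2 * π * t0 D| ≤ ell1 D + 1 := by linarith [hw2]
    have hclear : ∀ ρ : ℂ, x.ψ.LFunction ρ = 0 → 1 * alpha D ≤ ‖w - ρ‖ := by
      intro ρ hρ; rw [one_mul]; exact clearance_of_prop22i (h22x x hx) hα4 hw1' hw3 ρ hρ
    have h59w := h59 D χ hD59 hq hp x hx w hw1 hw2 hclear
    rw [bigP, Real.log_exp] at h59w
    have hMnorm : ‖(((x.p : ℝ) * t0 D : ℝ) : ℂ) ^ (-beta1 c' D) *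
        (x.ψ⁻¹.LFunction (1 - s - beta1 c' D) / x.ψ⁻¹.LFunction (1 - s))‖ ≤ |C₅₉| * ell D ^ 9 := by
      rw [norm_mul, hn1, one_mul, norm_reflected_ratio_eq c' x s]
      exact h59w.trans (mul_le_mul_of_nonneg_right (le_abs_self _) (by positivity))
    -- the identity and the product of the bounds
    have hfirst : ‖x.ψ.LFunction (s + beta1 c' D) / x.ψ.LFunction s -
        (((x.p : ℝ) * t0 D : ℝ) : ℂ) ^ (-beta1 c' D) *
          (x.ψ⁻¹.LFunction (1 - s - beta1 c' D) / x.ψ⁻¹.LFunction (1 - s))‖ ≤ E := by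
      refine h10.trans ?_
      rw [hE]
      exact mul_le_mul_of_nonneg_left hMnorm (by positivity)
    have hAB : ‖(((x.p : ℝ) * t0 D : ℝ) : ℂ) ^ beta3 c' D *
        (x.ψ.LFunction (s + beta1 c' D) / x.ψ.LFunction s -
          (((x.p : ℝ) * t0 D : ℝ) : ℂ) ^ (-beta1 c' D) *
            (x.ψ⁻¹.LFunction (1 - s - beta1 c' D) / x.ψ⁻¹.LFunction (1 - s)))‖ ≤ E := by
      rw [norm_mul, hn3, one_mul]; exact hfirst
    have hW : ‖(Bpoly χ x s * Gpoly χ x s * Nchar D (psiFn x) (s + beta2 c' D) *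
            Nchar D (psiFn x) (s + beta3 c' D)) * FpolyBar χ x (1 - s) * omegaW D s‖ =
        ‖Bpoly χ x s * Gpoly χ x s * Nchar D (psiFn x) (s + beta2 c' D) *
            Nchar D (psiFn x) (s + beta3 c' D)‖ * ‖FpolyBar χ x (1 - s)‖ * ‖omegaW D s‖ := by
      rw [norm_mul, norm_mul]
    rw [kfrak3_weighted_sub_eq c' χ x hℓ0 s]
    calc _ ≤ ‖(((x.p : ℝ) * t0 D : ℝ) : ℂ) ^ beta3 c' D *
          (x.ψ.LFunction (s + beta1 c' D) / x.ψ.LFunction s -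
            (((x.p : ℝ) * t0 D : ℝ) : ℂ) ^ (-beta1 c' D) *
              (x.ψ⁻¹.LFunction (1 - s - beta1 c' D) / x.ψ⁻¹.LFunction (1 - s)))‖ *
          ‖(Bpoly χ x s * Gpoly χ x s * Nchar D (psiFn x) (s + beta2 c' D) *
            Nchar D (psiFn x) (s + beta3 c' D)) * FpolyBar χ x (1 - s) * omegaW D s‖ :=
        norm_mul_le _ _
      _ ≤ E * (‖Bpoly χ x s * Gpoly χ x s * Nchar D (psiFn x) (s + beta2 c' D) *
            Nchar D (psiFn x) (s + beta3 c' D)‖ * ‖FpolyBar χ x (1 - s)‖ * ‖omegaW D s‖) := by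
        rw [← hW]; exact mul_le_mul_of_nonneg_right hAB (norm_nonneg _)
      _ = _ := by ring
  -- (2) integrability of the two integrands along `𝔍(−α)` (no zero of `L(s,ψ)`, `L(1−s,ψ̄)` there)
  have hpathc : Continuous fun v : ℝ => z + s0 (t0 D) + (v : ℂ) * I := by fun_prop
  have hintF : ∀ x ∈ PsiOne χ, IntervalIntegrable
      (fun v : ℝ => kfrak3 c' χ x (z + s0 (t0 D) + v * I) * omegaW D (z + s0 (t0 D) + v * I))
      volume (-ell1 D) (ell1 D) := by
    intro x hx
    refine ContinuousOn.intervalIntegrable ?_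
    rw [Set.uIcc_of_le (by linarith)]
    -- no zero of `L(s,ψ)` on `σ = ½ − α`, `|y − 2πt₀| ≤ 𝓛₁` (Prop. 2.2 (i))
    have hLnz : ∀ y ∈ Icc (2 * π * t0 D - ell1 D) (2 * π * t0 D + ell1 D),
        x.ψ.LFunction ((((1 / 2 - alpha D : ℝ)) : ℂ) + y * I) ≠ 0 := by
      intro y hy h0
      have hσ : |((((1 / 2 - alpha D : ℝ)) : ℂ) + y * I).re - 1 / 2| = alpha D := by
        have : ((((1 / 2 - alpha D : ℝ)) : ℂ) + y * I).re = 1 / 2 - alpha D := by simp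
        rw [this, show 1 / 2 - alpha D - 1 / 2 = -alpha D by ring, abs_neg, abs_of_pos hα0]
      have hy' : |((((1 / 2 - alpha D : ℝ)) : ℂ) + y * I).im - 2 * π * t0 D| ≤ ell1 D + 1 := by
        have : ((((1 / 2 - alpha D : ℝ)) : ℂ) + y * I).im = y := by simp
        rw [this, abs_le]; constructor <;> linarith [hy.1, hy.2]
      have h := clearance_of_prop22i (h22x x hx) hα4 hσ hy' _ h0
      rw [sub_self, norm_zero] at h
      linarith
    have hcont := continuousOn_kfrak3_omega_vertical c' χ x (1 / 2 - alpha D) hLnz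
    have hcomp : ContinuousOn (fun v : ℝ => 2 * π * t0 D + v) (Icc (-ell1 D) (ell1 D)) :=
      (continuous_const.add continuous_id).continuousOn
    have hmaps : MapsTo (fun v : ℝ => 2 * π * t0 D + v) (Icc (-ell1 D) (ell1 D))
        (Icc (2 * π * t0 D - ell1 D) (2 * π * t0 D + ell1 D)) := by
      intro v hv; exact ⟨by linarith [hv.1], by linarith [hv.2]⟩
    have h := hcont.comp hcomp hmaps
    refine h.congr (fun v _ => ?_)
    simp only [Function.comp_apply, hpath v]
  have hintG : ∀ x ∈ PsiOne χ, IntervalIntegrable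
      (fun v : ℝ => kfrak3Star c' χ x (z + s0 (t0 D) + v * I) * omegaW D (z + s0 (t0 D) + v * I))
      volume (-ell1 D) (ell1 D) := by
    intro x hx
    refine ContinuousOn.intervalIntegrable ?_
    rw [Set.uIcc_of_le (by linarith)]
    have hd := (Eq177.differentiableOn_kfrak3Star_omega c' x (h22x x hx) hα0 hα1).continuousOn
    have hmaps : MapsTo (fun v : ℝ => z + s0 (t0 D) + (v : ℂ) * I) (Icc (-ell1 D) (ell1 D))
        (Set.uIcc (1 / 2 + -1) (1 / 2 + -alpha D) ×ℂ
          Set.uIcc (2 * π * t0 D - ell1 D) (2 * π * t0 D + ell1 D)) := by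
      intro v hv
      refine ⟨?_, ?_⟩
      · show (z + s0 (t0 D) + (v : ℂ) * I).re ∈ Set.uIcc (1 / 2 + -1) (1 / 2 + -alpha D)
        rw [hre_v, Set.uIcc_of_le (by linarith)]; exact ⟨by linarith, by linarith⟩
      · show (z + s0 (t0 D) + (v : ℂ) * I).im ∈ Set.uIcc (2 * π * t0 D - ell1 D) (2 * π * t0 D + ell1 D)
        rw [him_v, Set.uIcc_of_le (by linarith)]; exact ⟨by linarith [hv.1], by linarith [hv.2]⟩
    exact hd.comp hpathc.continuousOn hmaps
  -- (3) the majorant `g_ψ(v) = E·‖BGNN‖‖F̄‖·‖ω‖` is continuous, and its sum over `Ψ₁` is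
  --     `≤ E·R·‖ω(s_v)‖` pointwise (the loss-free mean value)
  set R : ℝ := Real.exp (8 * π) * frakP D *
    Real.sqrt ((Kι ^ 2 * (majorantConst 36 14 * (Real.log ⌊bigP D⌋₊ ^ 4 *
      Real.log ⌈2 * bigT D ^ 2⌉₊ ^ 20 * Real.log ((D ^ 4 : ℕ) : ℝ) ^ 12))) *
      (majorantConst 4 4 * Real.log ⌊bigP D⌋₊ ^ 4)) with hR
  have hP0 : 0 ≤ frakP D := by
    rw [frakP_eq_sum_primeWindow]; exact Finset.sum_nonneg fun p _ => Nat.cast_nonneg p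
  have hR0 : 0 ≤ R := by rw [hR]; positivity
  set g : Chr D → ℝ → ℝ := fun x v =>
    E * (‖Bpoly χ x (z + s0 (t0 D) + v * I) * Gpoly χ x (z + s0 (t0 D) + v * I) *
          Nchar D (psiFn x) (z + s0 (t0 D) + v * I + beta2 c' D) *
          Nchar D (psiFn x) (z + s0 (t0 D) + v * I + beta3 c' D)‖ *
        ‖FpolyBar χ x (1 - (z + s0 (t0 D) + v * I))‖) *
      ‖omegaW D (z + s0 (t0 D) + v * I)‖ with hg
  have hofReal : Continuous fun v : ℝ => (v : ℂ) := Complex.continuous_ofReal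
  have hgc : ∀ x : Chr D, Continuous (g x) := by
    intro x
    have hB : Continuous (Bpoly χ x) := (differentiable_Bpoly χ x).continuous
    have hG : Continuous (Gpoly χ x) := (differentiable_Gpoly χ x).continuous
    have hN : Continuous (Nchar D (psiFn x)) := (differentiable_Nchar (D := D) (psiFn x)).continuous
    have hF : Continuous (FpolyBar χ x) := (differentiable_FpolyBar' χ x).continuous
    have hω : Continuous (omegaW D) := (Section7aStatements.differentiable_omegaW D).continuous
    simp only [hg]
    fun_prop
  have hsumg : ∀ v ∈ Icc (-ell1 D) (ell1 D),
      ∑ x ∈ finsetOf (PsiOne χ), g x v ≤ E * R * ‖omegaW D (z + s0 (t0 D) + v * I)‖ := by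
    intro v _
    have hs1 : |(z + s0 (t0 D) + v * I).re - 1 / 2| ≤ 2 * alpha D := by
      rw [hre_v, show 1 / 2 - alpha D - 1 / 2 = -alpha D by ring, abs_neg, abs_of_pos hα0]
      linarith
    have hs2 : |(1 - (z + s0 (t0 D) + v * I)).re - 1 / 2| ≤ 2 * alpha D := by
      rw [Complex.sub_re, Complex.one_re, hre_v, show 1 - (1 / 2 - alpha D) - 1 / 2 = alpha D by ring,
        abs_of_pos hα0]
      linarith
    have hmv := sum_norm_BGNN_mul_FpolyBar_le c' χ hD3 hℓ4 hDP (finsetOf (PsiOne χ)) hs1 hs2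
    rw [← hKι, ← hR] at hmv
    have hrw : ∑ x ∈ finsetOf (PsiOne χ), g x v =
        E * (∑ x ∈ finsetOf (PsiOne χ), ‖Bpoly χ x (z + s0 (t0 D) + v * I) *
            Gpoly χ x (z + s0 (t0 D) + v * I) *
            Nchar D (psiFn x) (z + s0 (t0 D) + v * I + beta2 c' D) *
            Nchar D (psiFn x) (z + s0 (t0 D) + v * I + beta3 c' D)‖ *
          ‖FpolyBar χ x (1 - (z + s0 (t0 D) + v * I))‖) * ‖omegaW D (z + s0 (t0 D) + v * I)‖ := by
      simp only [hg]
      rw [Finset.mul_sum, Finset.sum_mul]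
    rw [hrw]
    exact mul_le_mul_of_nonneg_right (mul_le_mul_of_nonneg_left hmv hE0) (norm_nonneg _)
  -- (4) per `ψ`: the difference of the weighted segment integrals is `≤ (1/2π)∫ g_ψ`
  have hI4 : ∀ x : Chr D, I4 c' χ x (-alpha D) =
      Lemma81.segInt (t0 D) (ell1 D) z fun s => kfrak3 c' χ x s * omegaW D s := by
    intro x; rw [I4, Complex.ofReal_neg]
  have hper : ∀ x ∈ PsiOne χ,
      ‖(((x.p : ℝ) * t0 D : ℝ) : ℂ) ^ beta3 c' D * I4 c' χ x (-alpha D) -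
          (((x.p : ℝ) * t0 D : ℝ) : ℂ) ^ beta2 c' D *
            Lemma81.segInt (t0 D) (ell1 D) z (fun s => kfrak3Star c' χ x s * omegaW D s)‖ ≤
        1 / (2 * π) * ∫ v in (-ell1 D)..ell1 D, g x v := by
    intro x hx
    rw [hI4 x, weighted_segInt_sub (F := fun s => kfrak3 c' χ x s * omegaW D s)
      (G := fun s => kfrak3Star c' χ x s * omegaW D s) z _ _ (hintF x hx) (hintG x hx), norm_mul]
    have hn : ‖(1 / (2 * π) : ℂ)‖ = 1 / (2 * π) := by
      rw [show (1 / (2 * π) : ℂ) = ((1 / (2 * π) : ℝ) : ℂ) by push_cast; ring, Complex.norm_real,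
        Real.norm_eq_abs, abs_of_pos (by positivity)]
    rw [hn]
    refine mul_le_mul_of_nonneg_left ?_ (by positivity)
    refine intervalIntegral.norm_integral_le_of_norm_le (by linarith) ?_ ((hgc x).intervalIntegrable _ _)
    exact Filter.Eventually.of_forall fun v hv => by
      have h := hdiff x hx v ⟨hv.1.le, hv.2⟩
      simpa only [hg] using h
  -- (5) sum over `Ψ₁`, exchange sum and integral, and integrate `‖ω‖` ((7.4))
  have hgint : ∀ x ∈ finsetOf (PsiOne χ), IntervalIntegrable (g x) volume (-ell1 D) (ell1 D) :=
    fun x _ => (hgc x).intervalIntegrable _ _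
  have hωc : Continuous fun v : ℝ => ‖omegaW D (z + s0 (t0 D) + v * I)‖ :=
    ((Section7aStatements.differentiable_omegaW D).continuous.comp hpathc).norm
  have h74D : ∫ v in (-ell1 D)..ell1 D, ‖omegaW D (z + s0 (t0 D) + v * I)‖ ≤ C₇₄ := by
    have h := h74 D χ hD74 hq hp (-alpha D) (by
      rw [abs_neg, abs_of_pos hα0, hαeq]
      have h9 : (1 : ℝ) ≤ ell D ^ 9 := one_le_pow₀ hℓ1
      calc π / ell D ^ 9 ≤ π := div_le_self Real.pi_pos.le h9
        _ ≤ 4 := by linarith [Real.pi_lt_four]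
        _ ≤ ell D := by linarith
        _ ≤ ell D ^ 9 := le_self_pow₀ hℓ1 (by norm_num))
    simpa only [Section7aStatements.absIntJ, Skeleton.s0, hz, Complex.ofReal_neg] using h
  have hC₇₄ : C₇₄ ≤ |C₇₄| := by exact le_abs_self C₇₄
  calc ‖(∑ x ∈ finsetOf (PsiOne χ), (((x.p : ℝ) * t0 D : ℝ) : ℂ) ^ beta3 c' D * I4 c' χ x (-alpha D)) -
        ∑ x ∈ finsetOf (PsiOne χ), (((x.p : ℝ) * t0 D : ℝ) : ℂ) ^ beta2 c' D *
          Lemma81.segInt (t0 D) (ell1 D) (-(alpha D : ℂ)) fun s => kfrak3Star c' χ x s * omegaW D s‖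
      = ‖∑ x ∈ finsetOf (PsiOne χ), ((((x.p : ℝ) * t0 D : ℝ) : ℂ) ^ beta3 c' D * I4 c' χ x (-alpha D) -
          (((x.p : ℝ) * t0 D : ℝ) : ℂ) ^ beta2 c' D *
            Lemma81.segInt (t0 D) (ell1 D) z fun s => kfrak3Star c' χ x s * omegaW D s)‖ := by
        rw [← Finset.sum_sub_distrib]
    _ ≤ ∑ x ∈ finsetOf (PsiOne χ), ‖(((x.p : ℝ) * t0 D : ℝ) : ℂ) ^ beta3 c' D * I4 c' χ x (-alpha D) -
          (((x.p : ℝ) * t0 D : ℝ) : ℂ) ^ beta2 c' D *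
            Lemma81.segInt (t0 D) (ell1 D) z fun s => kfrak3Star c' χ x s * omegaW D s‖ :=
        norm_sum_le _ _
    _ ≤ ∑ x ∈ finsetOf (PsiOne χ), 1 / (2 * π) * ∫ v in (-ell1 D)..ell1 D, g x v :=
        Finset.sum_le_sum fun x hx => hper x ((mem_finsetOf (Set.toFinite _)).mp hx)
    _ = 1 / (2 * π) * ∫ v in (-ell1 D)..ell1 D, ∑ x ∈ finsetOf (PsiOne χ), g x v := by
        rw [← Finset.mul_sum, intervalIntegral.integral_finsetSum hgint]
    _ ≤ 1 / (2 * π) * ∫ v in (-ell1 D)..ell1 D, E * R * ‖omegaW D (z + s0 (t0 D) + v * I)‖ := by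
        refine mul_le_mul_of_nonneg_left ?_ (by positivity)
        exact intervalIntegral.integral_mono_on (by linarith)
          ((continuous_finsetSum _ fun x _ => hgc x).intervalIntegrable _ _)
          ((continuous_const.mul hωc).intervalIntegrable _ _) hsumg
    _ = 1 / (2 * π) * (E * R) * ∫ v in (-ell1 D)..ell1 D, ‖omegaW D (z + s0 (t0 D) + v * I)‖ := by
        rw [intervalIntegral.integral_const_mul]; ring
    _ ≤ 1 / (2 * π) * (E * R) * |C₇₄| :=
        mul_le_mul_of_nonneg_left (h74D.trans hC₇₄) (by positivity)
    _ ≤ ε * frakP D := by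
        -- `(1/2π)·E·R·|C₇₄| = K₀'·𝓛⁹⁻¹²³·√(logs)·𝔓 ≤ K₀𝓛⁻⁵²𝔓 ≤ ε𝔓`
        obtain ⟨hP2, hy2, -⟩ := sizes_two_le hD3 hℓ1
        have hM1 := majorantConst_pos 36 14
        have hM2 := majorantConst_pos 4 4
        have hKι0 : 0 ≤ Kι := by rw [hKι]; positivity
        have hsq := sqrt_logs_le (M₁ := majorantConst 36 14) (M₂ := majorantConst 4 4) hKι0 hM1.le
          hM2.le hℓ4 hP2 hy2
        -- `R ≤ e^{8π}𝔓·(Kι·3¹⁰4⁶·√(M₁M₂))·𝓛⁶²`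
        have hRle : R ≤ Real.exp (8 * π) * frakP D *
            (Kι * (3 ^ 10 * 4 ^ 6) * Real.sqrt (majorantConst 36 14 * majorantConst 4 4) *
              ell D ^ 62) := by
          rw [hR]; exact mul_le_mul_of_nonneg_left hsq (by positivity)
        -- assemble: `(1/2π)·E·R·|C₇₄| ≤ K₀·𝓛⁻⁵²·𝔓`
        have h123 : (ell D ^ 123)⁻¹ * ell D ^ 9 * ell D ^ 62 = (ell D ^ 52)⁻¹ := ell_pow_combine hℓ0
        have hmain : 1 / (2 * π) * (E * R) * |C₇₄| ≤ K₀ * (ell D ^ 52)⁻¹ * frakP D := by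
          calc 1 / (2 * π) * (E * R) * |C₇₄|
              ≤ 1 / (2 * π) * (E * (Real.exp (8 * π) * frakP D *
                  (Kι * (3 ^ 10 * 4 ^ 6) * Real.sqrt (majorantConst 36 14 * majorantConst 4 4) *
                    ell D ^ 62))) * |C₇₄| := by
                refine mul_le_mul_of_nonneg_right (mul_le_mul_of_nonneg_left
                  (mul_le_mul_of_nonneg_left hRle hE0) (by positivity)) (abs_nonneg _)
            _ = K₀ * ((ell D ^ 123)⁻¹ * ell D ^ 9 * ell D ^ 62) * frakP D := by
                rw [hK₀, hE]; ring
            _ = K₀ * (ell D ^ 52)⁻¹ * frakP D := by rw [h123]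
        -- `K₀·𝓛⁻⁵² ≤ ε` since `𝓛 ≥ K₀/ε + 1` and `𝓛⁵² ≥ 𝓛`
        have hfin : K₀ * (ell D ^ 52)⁻¹ ≤ ε := final_le hε hℓ1 hKε
        calc 1 / (2 * π) * (E * R) * |C₇₄| ≤ K₀ * (ell D ^ 52)⁻¹ * frakP D := hmain
          _ ≤ ε * frakP D := mul_le_mul_of_nonneg_right hfin hP0

/-- **§17.u011 EVENTUALLY in `c′`**: some `c₀ ≥ 0` with `Step17_u011 c′` for all `c′ ≥ c₀` — from
`step17_u011_of_prop22` and Proposition 2.2 as landed in the tree (`Skeleton.prop22_eventually`).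
[cite: Zhang2022LandauSiegel, §17 u011 p. 97; §2 Prop. 2.2] -/
theorem step17_u011_eventually : ∃ c₀ : ℝ, 0 ≤ c₀ ∧ ∀ c' : ℝ, c₀ ≤ c' → Step17_u011 c' := by
  obtain ⟨c₀, hc₀, h⟩ := prop22_eventually
  exact ⟨c₀, hc₀, fun c' hc' => step17_u011_of_prop22 (hc₀.trans hc') (h c' hc')⟩

end Assembly

end Literature.NumberTheory.LFunctions.Zhang2022.Typed.Section17
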